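import Summits.ValiantsHypothesis.ValiantsHypothesis.Theorems.KPlusLogSqLawTropicalBVertexCount

/-!
# Route «KPlusLogSqLaw», crux `TropicalB` (stmt-ValiantsHypothesis-19771) — the FERRERS-RANK LAW: if the exponent matrix of a design is,
# on its support and modulo separable matrices, an integer combination of `r` Ferrers (biorder) `0/1` matrices, the design has fewer than
# `(m+1)^r` dominant terms

HONEST FRAMING.  Helper toward the registered stubs `stub_tropThin` / `stub_tropFat` of `Cruxes/TropicalB/Lines/birth.lean`
(crux `Summit.ValiantsHypothesis.ValiantsHypothesis.Theses.KPlusLogSqLaw.TropicalB`, item `stmt-ValiantsHypothesis-19771`, route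
`KPlusLogSqLaw`; cell `pub-symmetroid`, seat val-sym-trop-p1 g15, 2026-08-28; `--supports … --as helper`).  A slope-counting SECTOR law (the
linear-labelling counterpart of the threshold normal form `…TropicalBThresholdIff`: with an ARBITRARY labelling of the patterns of
`3(⌊log₂ m⌋+1)` order pairs every design occurs, `tropicalB_iff_logBoundaries`; with a LINEAR labelling of `r` biorders the census is
polynomial of degree `r`).
It generalises the tree's one-boundary law `BoundarySector.boundaryVertexLaw_one` (p447010) and the additive-exponent boundary law
(`…TropicalBBoundarySectorAdditive`) from dense boundary-type designs over permutation pairs to ARBITRARY supports, several classes per entry,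
NON-injective keys and signed integer coefficients.  Nothing here is in-window; nothing bears on `TropicalB`, `WeakLifting`, DoorA26 / DoorA34,
`MatrixDescartes` (stmt-ValiantsHypothesis-18050) or VP ≠ VNP.  No definition is introduced.

THE LAW.  Let `(d, v, ε)` be a design of format `(m, K)` and suppose there are keys `f g : Fin r → Fin m → ℤ`, coefficients `c : Fin r → ℤ`
and potentials `u w : Fin m → ℤ` such that every PRESENT incidence `ε a b l ≠ 0` has exponent
`d l = u a + w b + Σ_j c j · [f j a < g j b]` (a FERRERS REPRESENTATION of rank `r` of the exponent matrix on the support, modulo separable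
matrices).  Then the slope of a present term `(σ, λ)` is `Σ u + Σ w + Σ_j c j · N_j` with the biorder counts
`N_j = #{b : f j (σ b) < g j b} ∈ [0, m]` (`slope_eq_of_ferrers`), dominant terms have pairwise distinct slopes, and so

* `designRowD_of_ferrers` — every unsigned dominant chain has `n + 1 ≤ (m+1)^r`, i.e. `DesignRowD d v ε ((m+1)^r − 1)`;
* `card_dominant_le_of_ferrers` — at most `(m+1)^r` terms are dominant at some integer slope.
Instances: `r = 0` (separable slopes: one dominant term), `r = 1` with permutation keys (the wrap boundary: `≤ m + 1`, rotation registers),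
Toeplitz class maps with `t` displacement thresholds `[a + s_j < b]` (`r = t`), block-staircase class maps.  [folklore: slope counting]
-/

set_option linter.dupNamespace false
set_option autoImplicit false

namespace Summit.ValiantsHypothesis.ValiantsHypothesis.Theorems.KPlusLogSqLaw

namespace BoundarySector

open Summit.ValiantsHypothesis.ValiantsHypothesis.Theorems.MatrixDescartes.Negative
open Summit.ValiantsHypothesis.ValiantsHypothesis.Theorems.LacunarySymmetroidMatrixDescartes
open Summit.ValiantsHypothesis.ValiantsHypothesis.Theorems.LacunarySymmetroidMatrixDescartes.TropicalCensus
open scoped BigOperators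
open Finset

variable {m K r : ℕ}

/-- the biorder count `N_j(p) = #{b : f j (σ b) < g j b}` of a term. (local abbreviation-free form: a `Finset.card`) [folklore] -/
theorem biorderCount_le (f g : Fin r → Fin m → ℤ) (p : Equiv.Perm (Fin m) × (Fin m → Fin K)) (j : Fin r) :
    (univ.filter fun b : Fin m => f j (p.1 b) < g j b).card ≤ m :=
  (card_le_univ _).trans (by rw [Fintype.card_fin])

/-- **slope through a Ferrers representation**: for a present term, `slope = Σ u + Σ w + Σ_j c j · N_j`. [folklore] -/
theorem slope_eq_of_ferrers (d : Fin K → ℕ) (ε : Fin m → Fin m → Fin K → ℤ) (f g : Fin r → Fin m → ℤ) (c : Fin r → ℤ)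
    (u w : Fin m → ℤ)
    (hrep : ∀ a b l, ε a b l ≠ 0 → (d l : ℤ) = u a + w b + ∑ j, c j * (if f j a < g j b then 1 else 0))
    {p : Equiv.Perm (Fin m) × (Fin m → Fin K)} (hp : termSign ε p ≠ 0) :
    TropicalCensus.slope d p = ∑ a, u a + ∑ b, w b + ∑ j, c j * ((univ.filter fun b : Fin m => f j (p.1 b) < g j b).card : ℤ) := by
  have hpres := (termSign_ne_zero_iff ε p).1 hp
  unfold TropicalCensus.slope
  calc ∑ b, (d (p.2 b) : ℤ) = ∑ b, (u (p.1 b) + w b + ∑ j, c j * (if f j (p.1 b) < g j b then 1 else 0)) :=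
        sum_congr rfl fun b _ => hrep _ _ _ (hpres b)
    _ = ∑ b, u (p.1 b) + ∑ b, w b + ∑ b, ∑ j, c j * (if f j (p.1 b) < g j b then 1 else 0) := by
        rw [sum_add_distrib, sum_add_distrib]
    _ = ∑ a, u a + ∑ b, w b + ∑ j, c j * ((univ.filter fun b : Fin m => f j (p.1 b) < g j b).card : ℤ) := by
        congr 1
        · congr 1
          exact Equiv.sum_comp p.1 u
        · rw [sum_comm]
          refine sum_congr rfl fun j _ => ?_
          rw [← mul_sum, Finset.natCast_card_filter]

/-- **THE FERRERS-RANK LAW (chain form).**  Under a Ferrers representation of rank `r` of the exponents on the support, every unsigned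
dominant chain has `n + 1 ≤ (m+1)^r`: `DesignRowD d v ε ((m+1)^r − 1)`. [folklore: slope counting] -/
theorem designRowD_of_ferrers (d : Fin K → ℕ) (v ε : Fin m → Fin m → Fin K → ℤ) (f g : Fin r → Fin m → ℤ) (c : Fin r → ℤ)
    (u w : Fin m → ℤ)
    (hrep : ∀ a b l, ε a b l ≠ 0 → (d l : ℤ) = u a + w b + ∑ j, c j * (if f j a < g j b then 1 else 0)) :
    DesignRowD d v ε ((m + 1) ^ r - 1) := by
  classical
  intro n θ p hθ hdom hne
  -- the count vector of a chain term, as a map `Fin r → Fin (m+1)`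
  let N : Fin (n + 1) → Fin r → Fin (m + 1) := fun k j =>
    ⟨(univ.filter fun b : Fin m => f j ((p k).1 b) < g j b).card, Nat.lt_succ_of_le (biorderCount_le f g (p k) j)⟩
  have hslope : ∀ k, TropicalCensus.slope d (p k) = ∑ a, u a + ∑ b, w b + ∑ j, c j * ((N k j : ℕ) : ℤ) := fun k =>
    slope_eq_of_ferrers d ε f g c u w hrep (hdom k).1
  have hsm := slope_strictMono_of_chainD d v ε θ p hθ hdom hne
  have hinj : Function.Injective N := by
    intro k k' hkk'
    apply hsm.injective
    show TropicalCensus.slope d (p k) = TropicalCensus.slope d (p k')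
    rw [hslope k, hslope k', hkk']
  have hcard := Fintype.card_le_of_injective N hinj
  rw [Fintype.card_fin, Fintype.card_fun, Fintype.card_fin, Fintype.card_fin] at hcard
  have hpos : 1 ≤ (m + 1) ^ r := Nat.one_le_pow _ _ (Nat.succ_pos m)
  omega

open scoped Classical in
/-- **THE FERRERS-RANK LAW (vertex count).**  Under a Ferrers representation of rank `r`, at most `(m+1)^r` terms of the design are dominant
at some integer slope. [folklore] -/
theorem card_dominant_le_of_ferrers (d : Fin K → ℕ) (v ε : Fin m → Fin m → Fin K → ℤ) (f g : Fin r → Fin m → ℤ) (c : Fin r → ℤ)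
    (u w : Fin m → ℤ)
    (hrep : ∀ a b l, ε a b l ≠ 0 → (d l : ℤ) = u a + w b + ∑ j, c j * (if f j a < g j b then 1 else 0)) :
    (univ.filter fun q : Equiv.Perm (Fin m) × (Fin m → Fin K) => ∃ t : ℤ, IsDominant d v ε t q).card ≤ (m + 1) ^ r := by
  have h := card_dominant_le_succ d v ε (designRowD_of_ferrers d v ε f g c u w hrep)
  have hpos : 1 ≤ (m + 1) ^ r := Nat.one_le_pow _ _ (Nat.succ_pos m)
  omega

open scoped Classical in
/-- **Instance: one permutation boundary** (the shape of `boundaryVertexLaw_one`, here for ANY support and any classes whose exponent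
depends only on the side of the boundary): if every present incidence at `(a, b)` has exponent `e₀` when `¬ π a < ρ b` and `e₁` when
`π a < ρ b`, then at most `m + 1` terms are dominant. [folklore] -/
theorem card_dominant_le_of_one_boundary (d : Fin K → ℕ) (v ε : Fin m → Fin m → Fin K → ℤ) (π ρ : Equiv.Perm (Fin m))
    (e₀ e₁ : ℕ) (hrep : ∀ a b l, ε a b l ≠ 0 → d l = if π a < ρ b then e₁ else e₀) :
    (Finset.univ.filter fun q : Equiv.Perm (Fin m) × (Fin m → Fin K) =>
      ∃ t : ℤ, IsDominant d v ε t q).card ≤ m + 1 := by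
  classical
  have h := card_dominant_le_of_ferrers d v ε (r := 1) (fun _ a => ((π a : ℕ) : ℤ)) (fun _ b => ((ρ b : ℕ) : ℤ))
    (fun _ => (e₁ : ℤ) - e₀) (fun _ => (e₀ : ℤ)) (fun _ => 0) ?_
  · simpa using h
  · intro a b l hl
    rw [hrep a b l hl]
    simp only [Fin.sum_univ_one, Nat.cast_lt, Fin.val_fin_lt, add_zero]
    split_ifs <;> ring

end BoundarySector

end Summit.ValiantsHypothesis.ValiantsHypothesis.Theorems.KPlusLogSqLaw
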